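import Mathlib
import Summits.KontsevichZagierPeriods.Zeta5Search.Families.ExactS8hValue
import Summits.KontsevichZagierPeriods.Zeta5Search.Families.BasicGrowthEightExact
import Summits.KontsevichZagierPeriods.Zeta5Search.Families.BasicGrowthSymmetryAPI
import HarnessLib

/-!
# ζ(5) search — Families: the dual pair `₈π₈^∨ / ₈π₈` and Brown–Zudilin's cubic — `M_{₈π₈^∨} = λ₁`, `M_{₈π₈} = 1/λ₃`

HONEST FRAMING: systematic search; no irrationality claim unless certified.  STRUCTURAL facts about the size of
Brown's basic cellular integrals [Brown2016, §1.5] (seat P2, Families layer); nothing about the arithmetic of any zeta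
value.

`Families/BasicGrowthEightExact.lean`: the growth constant of the Brown–Zudilin configuration `₈π₈^∨` (`pi8dual`) is the
SMALLEST root `λ₁ = 0.0050037…` of `χ(λ) = 4λ³ − 2368λ² − 188λ + 1` [BrownZudilin2022, §2].
`Families/ExactS8hValue.lean`: the growth constant of the configuration `sigmaS8h = (0,2,5,1,6,4,7,3)` — a representative
of the class of the INVERSE seating of `pi8dual`, i.e. of Brown's dual dinner party `₈π₈` — is the root of
`minpolyS8h(x) = x³ − 188x² − 2368x + 4` near `0.0016889627`.  This file records the relation between the two:
* `minpolyS8h_eq_mul_charPoly_inv` — `minpolyS8h(x) = x³ · χ(1/x)`: the two minimal polynomials are RECIPROCAL;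
* `charPoly_inv_fSup_S8h` — hence `χ(1/M_{₈π₈}) = 0`;
* **`fSup_S8h_mul_eq_one_of_charPoly`** / **`exists_fSup_S8h_eq_inv`** — `M_{₈π₈} · λ₃ = 1` for the LARGEST root
  `λ₃ = 592.0793805…` of `χ` (the bracket of `charPoly_roots`), i.e. `M_{₈π₈} = 1/λ₃`: the decay rate of the basic
  cellular integrals of the dual configuration is the reciprocal of the growth rate `λ₃` of the leading coefficients
  `Q_n` of the Brown–Zudilin totally symmetric forms ([BrownZudilin2022, §2]: `log Q_n / n → log λ₃`, a named fact
  `BrownZudilin2022.rates` in the tree, not used here).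
NUMERICAL REMARK (not asserted): the same reciprocity `minpoly(M_{σ⁻¹})(x) = x^d · minpoly(M_σ)(1/x)` (up to sign) holds
for all 18 classes of convergent configurations with `N ≤ 8` (P2 g5, `HOME/pub-zeta5-p2/g5/`), e.g. `φ^{∓5}` (`N = 5`),
`(√2 ∓ 1)^4` (`N = 6`, self-dual); it suggests that the coefficient growth rate of a cellular family is the capacity
`1/M` of the DUAL configuration.  Standard axioms only.
-/

noncomputable section

open MeasureTheory Set Finset Filter Topology
open Literature.NumberTheory.Irrationality

namespace Summit.KontsevichZagierPeriods.Zeta5Search.Families.Cellular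

/-- The minimal polynomials of `M_{₈π₈}` and `M_{₈π₈^∨}` are reciprocal: `minpolyS8h(x) = x³ · χ(1/x)` (`x ≠ 0`). -/
theorem minpolyS8h_eq_mul_charPoly_inv {x : ℝ} (hx : x ≠ 0) :
    minpolyS8h x = x ^ 3 * BrownZudilin2022.charPoly (1 / x) := by
  unfold minpolyS8h BrownZudilin2022.charPoly
  field_simp

/-- `χ(1 / M_{₈π₈}) = 0`. -/
theorem charPoly_inv_fSup_S8h : BrownZudilin2022.charPoly (1 / fSup sigmaS8h) = 0 := by
  have hpos : 0 < fSup sigmaS8h := fSup_pos sigmaS8h sigmaS8h_bijective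
  have h := minpoly_fSup_S8h
  rw [minpolyS8h_eq_mul_charPoly_inv hpos.ne'] at h
  rcases mul_eq_zero.1 h with h3 | h3
  · exact absurd h3 (pow_ne_zero 3 hpos.ne')
  · exact h3

/-- `1 / M_{₈π₈}` lies in `(592.07, 592.09)`. -/
theorem inv_fSup_S8h_mem : 1 / fSup sigmaS8h ∈ Set.Ioo (592.07 : ℝ) 592.09 := by
  have hmem := fSup_S8h_mem_Ioo
  have hpos : 0 < fSup sigmaS8h := fSup_pos sigmaS8h sigmaS8h_bijective
  constructor
  · rw [lt_div_iff₀ hpos]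
    nlinarith [hmem.2]
  · rw [div_lt_iff₀ hpos]
    nlinarith [hmem.1]

/-- **`M_{₈π₈} · λ₃ = 1`**: for the root `λ₃ ∈ (592.0793805, 592.0793806)` of `χ`, the growth constant of the dual
configuration `sigmaS8h` is its reciprocal. -/
theorem fSup_S8h_mul_eq_one_of_charPoly {lam : ℝ} (hχ : BrownZudilin2022.charPoly lam = 0)
    (h1 : (5920793805 : ℝ) / 10 ^ 7 < lam) (h2 : lam < (5920793806 : ℝ) / 10 ^ 7) :
    fSup sigmaS8h * lam = 1 := by
  have hpos : 0 < fSup sigmaS8h := fSup_pos sigmaS8h sigmaS8h_bijective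
  set u : ℝ := 1 / fSup sigmaS8h with hu
  have hχu : BrownZudilin2022.charPoly u = 0 := charPoly_inv_fSup_S8h
  have humem := inv_fSup_S8h_mem
  rw [← hu] at humem
  -- both `u` and `lam` are roots of `χ` in `(592, 593)`, where `χ` is injective
  have hfac : (u - lam) * (4 * (u ^ 2 + u * lam + lam ^ 2) - 2368 * (u + lam) - 188) = 0 := by
    unfold BrownZudilin2022.charPoly at hχu hχ
    linear_combination hχu - hχ
  have hsecond : 0 < 4 * (u ^ 2 + u * lam + lam ^ 2) - 2368 * (u + lam) - 188 := by
    have hu1 : (592.07 : ℝ) < u := humem.1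
    have hl1 : (592 : ℝ) < lam := by linarith
    nlinarith [mul_pos (by linarith : (0 : ℝ) < u - 500) (by linarith : (0 : ℝ) < lam - 500)]
  have hul : u = lam := by
    rcases mul_eq_zero.1 hfac with h | h
    · linarith
    · exact absurd h hsecond.ne'
  rw [← hul, hu, mul_one_div_cancel hpos.ne']

/-- **`M_{₈π₈} = 1/λ₃`**, `λ₃` the largest root of Brown–Zudilin's `χ`. -/
theorem exists_fSup_S8h_eq_inv :
    ∃ lam : ℝ, lam ∈ Set.Ioo ((5920793805 : ℝ) / 10 ^ 7) ((5920793806 : ℝ) / 10 ^ 7) ∧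
      BrownZudilin2022.charPoly lam = 0 ∧ fSup sigmaS8h = 1 / lam := by
  obtain ⟨lam, hmem, hχ⟩ := BrownZudilin2022.charPoly_roots.2.2
  refine ⟨lam, hmem, hχ, ?_⟩
  have h := fSup_S8h_mul_eq_one_of_charPoly hχ hmem.1 hmem.2
  have hl : lam ≠ 0 := by have := hmem.1; intro h0; rw [h0] at this; norm_num at this
  field_simp
  linarith [h]

/-- The inverse seating of `₈π₈^∨`: `pi8dualInv (pi8dual i) = i` — Brown's dual plan `₈π₈`, 0-based (`7 = ∞`). -/
def pi8dualInv : Fin 8 → Fin 8 := ![3, 1, 6, 2, 5, 7, 4, 0]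

/-- `pi8dualInv` is a left inverse of `pi8dual`. -/
theorem pi8dualInv_pi8dual : ∀ i, pi8dualInv (pi8dual i) = i := by decide

/-- `pi8dualInv` is a right inverse of `pi8dual`. -/
theorem pi8dual_pi8dualInv : ∀ i, pi8dual (pi8dualInv i) = i := by decide

/-- `sigmaS8h` represents the class of the dual plan: `pi8dualInv = reflIdx ∘ sigmaS8h + 5` (dihedral witness
`(c, k, rev, refl) = (0, 5, false, true)`), hence **`M_{₈π₈} := fSup pi8dualInv = fSup sigmaS8h`**. -/
theorem fSup_pi8dualInv : fSup pi8dualInv = fSup sigmaS8h :=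
  fSup_eq_of_dihedral (σ := sigmaS8h) sigmaS8h_bijective 0 5 false true (by decide)

/-- **`M_{₈π₈} · λ₃ = 1`** for the dual seating itself. -/
theorem fSup_pi8dualInv_mul_eq_one_of_charPoly {lam : ℝ} (hχ : BrownZudilin2022.charPoly lam = 0)
    (h1 : (5920793805 : ℝ) / 10 ^ 7 < lam) (h2 : lam < (5920793806 : ℝ) / 10 ^ 7) :
    fSup pi8dualInv * lam = 1 := by
  rw [fSup_pi8dualInv]; exact fSup_S8h_mul_eq_one_of_charPoly hχ h1 h2

/-- **The dual pair and the cubic**: `M_{₈π₈^∨} = λ₁` and `M_{₈π₈} = 1/λ₃` for the smallest and the largest root of the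
same cubic `χ(λ) = 4λ³ − 2368λ² − 188λ + 1` of [BrownZudilin2022, §2]; in particular `M_{₈π₈^∨} / M_{₈π₈} = λ₁ λ₃`. -/
theorem fSup_pi8dual_div_fSup_S8h {lam1 lam3 : ℝ} (h1 : BrownZudilin2022.charPoly lam1 = 0)
    (h1a : (5003781 : ℝ) / 10 ^ 9 < lam1) (h1b : lam1 < (5003782 : ℝ) / 10 ^ 9)
    (h3 : BrownZudilin2022.charPoly lam3 = 0)
    (h3a : (5920793805 : ℝ) / 10 ^ 7 < lam3) (h3b : lam3 < (5920793806 : ℝ) / 10 ^ 7) :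
    fSup pi8dual / fSup sigmaS8h = lam1 * lam3 := by
  have hpos : 0 < fSup sigmaS8h := fSup_pos sigmaS8h sigmaS8h_bijective
  rw [fSup_pi8dual_eq_of_charPoly h1 h1a h1b, div_eq_iff hpos.ne']
  have h := fSup_S8h_mul_eq_one_of_charPoly h3 h3a h3b
  linear_combination -lam1 * h

end Summit.KontsevichZagierPeriods.Zeta5Search.Families.Cellular
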